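import Summits.MatrixMultiplication.MatrixMultiplication.Theorems.SoloInformedValTrapezoid

/-!
# SoloInformedValNormalForm — digit products of trapezoid-free triples: `Val(N) ≥ (N+1)^{1.0011}`

Sequel to `SoloInformedValTrapezoid` (notation and Pratt's definitions recalled there; arXiv:2309.03878,
Def. 3.2/4.2, Conj. 4.1, Prop. 4.3).  A *configuration of modulus `n`* is a triple `A, B, C ⊆ {0,…,n}` that is
equilateral trapezoid-free for the target `n` and satisfies `a + b + c ≤ 2n` on all of `A × B × C` (`Config`).
Results (all sorry-free, standard axioms):

* `config_ABC`, `card_solutions_ABC_ge` : the translate `(A₀, B₀, C₀) = (X + 17952, Y + 17952, Z + 17440)` of the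
  base instance is a configuration of modulus `53344` with `≥ 54000` solutions of `a + b + c = 53344`;
  in particular `Val(53344) ≥ 54000 > 53345`.
* `config_pair`, `card_solutions_pair` (digit-product lemma): if `(A,B,C)` and `(A',B',C')` are configurations
  of moduli `n, n'` with `T, T'` solutions, then `{a + (n+1)a'} …` is a configuration of modulus
  `n + (n+1)n'` (so `(n+1)(n'+1) - 1`) with `≥ T·T'` solutions.  The point is carry-freeness (`digit_split`):
  a low digit sum in `[0, 2n]` and a total `n + (n+1)t'` force both digit sums.
* `val_family` : for every `m` there is a configuration of modulus `N = 53345^(m+1) - 1` with at least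
  `54000^(m+1) = (N+1)^κ` solutions, `κ = log 54000 / log 53345 = 1.00112…`; `val_family_rpow` states it with
  the real exponent and `one_lt_kappa` records `κ > 1`.

Consequence.  `Val(N) ≥ (N+1)^κ` for infinitely many `N`; with Pratt's Prop. 4.3 (`Val(ℤ_n) ≥ Val(⌊n/3⌋)`)
this gives `Val(ℤ_n) ≥ Ω(n^κ)` along `n = 3N`, contradicting Conjecture 4.1 (`Val(ℤ_n) ≤ O(n^{1+ε})` for
all `ε > 0`).  The soloist's dossier (`paper/val-superlinear.md`) has the wider family (width `3m`, base `β`)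
with exponent `→ (log 2 + 3 log(β-3)) / (3 log β) ≈ 1.044` and the discussion of what this does and does not
say about `ω` (nothing directly: the two-family barrier theorems of Pratt §4 become vacuous, no upper bound moves).
-/

namespace Summit.MatrixMultiplication.MatrixMultiplication.Theorems.SoloVal

open Finset

/-! ## One system, three rotations -/

/-- One of Pratt's systems: for fixed `a' ∈ A`, `b' ∈ B` at most one `c ∈ C` with `t - a' - c ∈ B` and
`t - b' - c ∈ A`. -/
def Sys (A B C : Finset ℤ) (t : ℤ) : Prop :=
  ∀ a' ∈ A, ∀ b' ∈ B, ∀ c₁ ∈ C, ∀ c₂ ∈ C,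
    t - a' - c₁ ∈ B → t - b' - c₁ ∈ A → t - a' - c₂ ∈ B → t - b' - c₂ ∈ A → c₁ = c₂

/-- Trapezoid-freeness is the conjunction of the system for `(A,B,C)`, `(A,C,B)` and `(B,C,A)`. -/
theorem trapezoidFree_iff {A B C : Finset ℤ} {t : ℤ} :
    TrapezoidFree A B C t ↔ Sys A B C t ∧ Sys A C B t ∧ Sys B C A t := Iff.rfl

/-- Translation invariance of a system. -/
theorem sys_shift {A B C : Finset ℤ} {t : ℤ} (α β γ : ℤ) (h : Sys A B C t) :
    Sys (A.image (· + α)) (B.image (· + β)) (C.image (· + γ)) (t + α + β + γ) := by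
  have back : ∀ {S : Finset ℤ} {δ z : ℤ}, z ∈ S.image (· + δ) → z - δ ∈ S := by
    intro S δ z hz
    obtain ⟨s, hs, rfl⟩ := mem_image.1 hz
    simpa using hs
  intro a' ha' b' hb' c₁ hc₁ c₂ hc₂ k1 k2 k3 k4
  simp only [mem_image] at ha' hb' hc₁ hc₂
  obtain ⟨a₀, ha₀, rfl⟩ := ha'
  obtain ⟨b₀, hb₀, rfl⟩ := hb'
  obtain ⟨x₁, hx₁, rfl⟩ := hc₁
  obtain ⟨x₂, hx₂, rfl⟩ := hc₂
  have l1 := back k1; have l2 := back k2; have l3 := back k3; have l4 := back k4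
  have e1 : t + α + β + γ - (a₀ + α) - (x₁ + γ) - β = t - a₀ - x₁ := by ring
  have e2 : t + α + β + γ - (b₀ + β) - (x₁ + γ) - α = t - b₀ - x₁ := by ring
  have e3 : t + α + β + γ - (a₀ + α) - (x₂ + γ) - β = t - a₀ - x₂ := by ring
  have e4 : t + α + β + γ - (b₀ + β) - (x₂ + γ) - α = t - b₀ - x₂ := by ring
  rw [e1] at l1; rw [e2] at l2; rw [e3] at l3; rw [e4] at l4
  rw [h a₀ ha₀ b₀ hb₀ x₁ hx₁ x₂ hx₂ l1 l2 l3 l4]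

/-- Translation invariance of trapezoid-freeness. -/
theorem trapezoidFree_shift {A B C : Finset ℤ} {t : ℤ} (α β γ : ℤ) (h : TrapezoidFree A B C t) :
    TrapezoidFree (A.image (· + α)) (B.image (· + β)) (C.image (· + γ)) (t + α + β + γ) := by
  rw [trapezoidFree_iff] at h ⊢
  refine ⟨sys_shift α β γ h.1, ?_, ?_⟩
  · have := sys_shift α γ β h.2.1
    rwa [show t + α + γ + β = t + α + β + γ by ring] at this
  · have := sys_shift β γ α h.2.2
    rwa [show t + β + γ + α = t + α + β + γ by ring] at this

/-- Translation does not decrease the number of solutions. -/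
theorem card_solutions_shift {A B C : Finset ℤ} {t : ℤ} (α β γ : ℤ) :
    (solutions A B C t).card ≤
      (solutions (A.image (· + α)) (B.image (· + β)) (C.image (· + γ)) (t + α + β + γ)).card := by
  refine card_le_card_of_injOn (fun x => (x.1 + α, x.2.1 + β, x.2.2 + γ)) ?_ ?_
  · rintro ⟨a, b, c⟩ hx
    rw [mem_coe] at hx ⊢
    simp only [solutions, mem_filter, mem_product] at hx ⊢
    obtain ⟨⟨ha, hb, hc⟩, hs⟩ := hx
    exact ⟨⟨mem_image.2 ⟨a, ha, rfl⟩, mem_image.2 ⟨b, hb, rfl⟩, mem_image.2 ⟨c, hc, rfl⟩⟩, by omega⟩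
  · rintro ⟨a, b, c⟩ - ⟨a', b', c'⟩ - h
    simp only [Prod.mk.injEq, add_left_inj] at h
    obtain ⟨rfl, rfl, rfl⟩ := h
    rfl

/-! ## Configurations and the normal form of the base instance -/

/-- A configuration of modulus `n`: parts in `[0, n]`, trapezoid-free for the target `n`, and all sums
`a + b + c ≤ 2n` (the carry-freeness hypothesis of the digit product). -/
def Config (A B C : Finset ℤ) (n : ℤ) : Prop :=
  0 ≤ n ∧ TrapezoidFree A B C n ∧ (∀ a ∈ A, 0 ≤ a ∧ a ≤ n) ∧ (∀ b ∈ B, 0 ≤ b ∧ b ≤ n) ∧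
    (∀ c ∈ C, 0 ≤ c ∧ c ≤ n) ∧ (∀ a ∈ A, ∀ b ∈ B, ∀ c ∈ C, a + b + c ≤ 2 * n)

/-- `A₀ = X + 17952`. -/
noncomputable def A₀ : Finset ℤ := X.image (· + 17952)
/-- `B₀ = Y + 17952`. -/
noncomputable def B₀ : Finset ℤ := Y.image (· + 17952)
/-- `C₀ = Z + 17440`. -/
noncomputable def C₀ : Finset ℤ := Z.image (· + 17440)

/-- `(A₀, B₀, C₀)` is a configuration of modulus `53344`. -/
theorem config_ABC : Config A₀ B₀ C₀ 53344 := by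
  refine ⟨by norm_num, ?_, ?_, ?_, ?_, ?_⟩
  · rw [show (53344 : ℤ) = 0 + 17952 + 17952 + 17440 by norm_num]
    exact trapezoidFree_shift 17952 17952 17440 trapezoidFree_XYZ
  · intro a ha
    obtain ⟨v, hv, rfl⟩ := mem_image.1 ha
    have := X_bound v hv
    constructor <;> omega
  · intro b hb
    obtain ⟨v, hv, rfl⟩ := mem_image.1 hb
    have := Y_bound v hv
    constructor <;> omega
  · intro c hc
    obtain ⟨v, hv, rfl⟩ := mem_image.1 hc
    have := Z_bound v hv
    constructor <;> omega
  · intro a ha b hb c hc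
    obtain ⟨u, hu, rfl⟩ := mem_image.1 ha
    obtain ⟨v, hv, rfl⟩ := mem_image.1 hb
    obtain ⟨w, hw, rfl⟩ := mem_image.1 hc
    have := X_bound u hu; have := Y_bound v hv; have := Z_bound w hw
    omega

/-- `a + b + c = 53344` has at least `54000 > 53345` solutions in `A₀ × B₀ × C₀`: `Val(53344) ≥ 54000`. -/
theorem card_solutions_ABC_ge : 54000 ≤ (solutions A₀ B₀ C₀ 53344).card := by
  rw [show (53344 : ℤ) = 0 + 17952 + 17952 + 17440 by norm_num]
  exact card_solutions_ge.trans (card_solutions_shift (A := X) (B := Y) (C := Z) (t := 0) 17952 17952 17440)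

/-! ## The digit product -/

/-- Carry-freeness: a low digit sum in `[0, 2n]` and a total `n + (n+1) t'` force both digit sums. -/
theorem digit_split {n s s' t' : ℤ} (hs0 : 0 ≤ s) (hs1 : s ≤ 2 * n)
    (h : s + (n + 1) * s' = n + (n + 1) * t') : s = n ∧ s' = t' := by
  have hn1 : (0 : ℤ) ≤ n + 1 := by linarith
  rcases lt_trichotomy s' t' with hlt | rfl | hgt
  · have h0 := mul_nonneg hn1 (show (0 : ℤ) ≤ t' - s' - 1 by linarith)
    have e : (n + 1) * (t' - s' - 1) = (n + 1) * t' - (n + 1) * s' - (n + 1) := by ring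
    rw [e] at h0
    exfalso; linarith
  · exact ⟨by linarith, rfl⟩
  · have h0 := mul_nonneg hn1 (show (0 : ℤ) ≤ s' - t' - 1 by linarith)
    have e : (n + 1) * (s' - t' - 1) = (n + 1) * s' - (n + 1) * t' - (n + 1) := by ring
    rw [e] at h0
    exfalso; linarith

/-- Digits in `[0, n]` are determined by the base-`(n+1)` value. -/
theorem digit_eq {n a a' b b' : ℤ} (ha0 : 0 ≤ a) (ha1 : a ≤ n) (hb0 : 0 ≤ b) (hb1 : b ≤ n)
    (h : a + (n + 1) * a' = b + (n + 1) * b') : a = b ∧ a' = b' := by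
  have hn1 : (0 : ℤ) ≤ n + 1 := by linarith
  rcases lt_trichotomy a' b' with hlt | rfl | hgt
  · have h0 := mul_nonneg hn1 (show (0 : ℤ) ≤ b' - a' - 1 by linarith)
    have e : (n + 1) * (b' - a' - 1) = (n + 1) * b' - (n + 1) * a' - (n + 1) := by ring
    rw [e] at h0
    exfalso; linarith
  · exact ⟨by linarith, rfl⟩
  · have h0 := mul_nonneg hn1 (show (0 : ℤ) ≤ a' - b' - 1 by linarith)
    have e : (n + 1) * (a' - b' - 1) = (n + 1) * a' - (n + 1) * b' - (n + 1) := by ring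
    rw [e] at h0
    exfalso; linarith

/-- Digit pairing in base `n + 1`: `{s + (n+1) s' : s ∈ S, s' ∈ S'}`. -/
noncomputable def pair (n : ℤ) (S S' : Finset ℤ) : Finset ℤ := (S ×ˢ S').image (fun p => p.1 + (n + 1) * p.2)

/-- Membership in `pair`. -/
theorem mem_pair {n : ℤ} {S S' : Finset ℤ} {x : ℤ} :
    x ∈ pair n S S' ↔ ∃ s s', s ∈ S ∧ s' ∈ S' ∧ s + (n + 1) * s' = x := by
  constructor
  · intro h
    obtain ⟨⟨s, s'⟩, hp, rfl⟩ := mem_image.1 h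
    exact ⟨s, s', (mem_product.1 hp).1, (mem_product.1 hp).2, rfl⟩
  · rintro ⟨s, s', hs, hs', rfl⟩
    exact mem_image.2 ⟨(s, s'), mem_product.2 ⟨hs, hs'⟩, rfl⟩

/-- The digit product of two systems is a system (carry-freeness from the low configuration). -/
theorem sys_pair {A B C A' B' C' : Finset ℤ} {n n' : ℤ}
    (hs : ∀ a ∈ A, ∀ b ∈ B, ∀ c ∈ C, 0 ≤ a + b + c ∧ a + b + c ≤ 2 * n)
    (h : Sys A B C n) (h' : Sys A' B' C' n') :
    Sys (pair n A A') (pair n B B') (pair n C C') (n + (n + 1) * n') := by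
  intro a'' ha'' b'' hb'' c₁ hc₁ c₂ hc₂ k1 k2 k3 k4
  simp only [mem_pair] at ha'' hb'' hc₁ hc₂ k1 k2 k3 k4
  obtain ⟨a₁, a₂, ha₁, ha₂, rfl⟩ := ha''
  obtain ⟨b₁, b₂, hb₁, hb₂, rfl⟩ := hb''
  obtain ⟨x₁, x₂, hx₁, hx₂, rfl⟩ := hc₁
  obtain ⟨y₁, y₂, hy₁, hy₂, rfl⟩ := hc₂
  obtain ⟨p₁, p₂, hp₁, hp₂, e1⟩ := k1
  obtain ⟨q₁, q₂, hq₁, hq₂, e2⟩ := k2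
  obtain ⟨r₁, r₂, hr₁, hr₂, e3⟩ := k3
  obtain ⟨s₁, s₂, hs₁, hs₂, e4⟩ := k4
  obtain ⟨d1, d1'⟩ := digit_split (hs a₁ ha₁ p₁ hp₁ x₁ hx₁).1 (hs a₁ ha₁ p₁ hp₁ x₁ hx₁).2
    (show a₁ + p₁ + x₁ + (n + 1) * (a₂ + p₂ + x₂) = n + (n + 1) * n' by linear_combination e1)
  obtain ⟨d2, d2'⟩ := digit_split (hs q₁ hq₁ b₁ hb₁ x₁ hx₁).1 (hs q₁ hq₁ b₁ hb₁ x₁ hx₁).2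
    (show q₁ + b₁ + x₁ + (n + 1) * (q₂ + b₂ + x₂) = n + (n + 1) * n' by linear_combination e2)
  obtain ⟨d3, d3'⟩ := digit_split (hs a₁ ha₁ r₁ hr₁ y₁ hy₁).1 (hs a₁ ha₁ r₁ hr₁ y₁ hy₁).2
    (show a₁ + r₁ + y₁ + (n + 1) * (a₂ + r₂ + y₂) = n + (n + 1) * n' by linear_combination e3)
  obtain ⟨d4, d4'⟩ := digit_split (hs s₁ hs₁ b₁ hb₁ y₁ hy₁).1 (hs s₁ hs₁ b₁ hb₁ y₁ hy₁).2
    (show s₁ + b₁ + y₁ + (n + 1) * (s₂ + b₂ + y₂) = n + (n + 1) * n' by linear_combination e4)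
  have m1 : n - a₁ - x₁ ∈ B := by rw [show n - a₁ - x₁ = p₁ by linarith]; exact hp₁
  have m2 : n - b₁ - x₁ ∈ A := by rw [show n - b₁ - x₁ = q₁ by linarith]; exact hq₁
  have m3 : n - a₁ - y₁ ∈ B := by rw [show n - a₁ - y₁ = r₁ by linarith]; exact hr₁
  have m4 : n - b₁ - y₁ ∈ A := by rw [show n - b₁ - y₁ = s₁ by linarith]; exact hs₁
  have m1' : n' - a₂ - x₂ ∈ B' := by rw [show n' - a₂ - x₂ = p₂ by linarith]; exact hp₂
  have m2' : n' - b₂ - x₂ ∈ A' := by rw [show n' - b₂ - x₂ = q₂ by linarith]; exact hq₂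
  have m3' : n' - a₂ - y₂ ∈ B' := by rw [show n' - a₂ - y₂ = r₂ by linarith]; exact hr₂
  have m4' : n' - b₂ - y₂ ∈ A' := by rw [show n' - b₂ - y₂ = s₂ by linarith]; exact hs₂
  rw [h a₁ ha₁ b₁ hb₁ x₁ hx₁ y₁ hy₁ m1 m2 m3 m4, h' a₂ ha₂ b₂ hb₂ x₂ hx₂ y₂ hy₂ m1' m2' m3' m4']

/-- The digit product of two configurations is a configuration of modulus `n + (n+1) n'`. -/
theorem config_pair {A B C A' B' C' : Finset ℤ} {n n' : ℤ} (hc : Config A B C n) (hc' : Config A' B' C' n') :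
    Config (pair n A A') (pair n B B') (pair n C C') (n + (n + 1) * n') := by
  obtain ⟨hn, ht, hA, hB, hC, hS⟩ := hc
  obtain ⟨hn', ht', hA', hB', hC', hS'⟩ := hc'
  have hn1 : (0 : ℤ) ≤ n + 1 := by linarith
  have lo : ∀ a ∈ A, ∀ b ∈ B, ∀ c ∈ C, 0 ≤ a + b + c ∧ a + b + c ≤ 2 * n := fun a ha b hb c hc =>
    ⟨by linarith [(hA a ha).1, (hB b hb).1, (hC c hc).1], hS a ha b hb c hc⟩
  -- range of a paired digit
  have rng : ∀ {S S' : Finset ℤ}, (∀ s ∈ S, 0 ≤ s ∧ s ≤ n) → (∀ s ∈ S', 0 ≤ s ∧ s ≤ n') →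
      ∀ x ∈ pair n S S', 0 ≤ x ∧ x ≤ n + (n + 1) * n' := by
    intro S S' h1 h2 x hx
    obtain ⟨s, s', hs, hs', rfl⟩ := mem_pair.1 hx
    have u := mul_le_mul_of_nonneg_left (h2 s' hs').2 hn1
    have v := mul_nonneg hn1 (h2 s' hs').1
    constructor <;> linarith [(h1 s hs).1, (h1 s hs).2]
  refine ⟨by nlinarith, ?_, rng hA hA', rng hB hB', rng hC hC', ?_⟩
  · rw [trapezoidFree_iff] at ht ht' ⊢
    refine ⟨sys_pair lo ht.1 ht'.1, sys_pair ?_ ht.2.1 ht'.2.1, sys_pair ?_ ht.2.2 ht'.2.2⟩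
    · intro a ha c hc b hb
      have := lo a ha b hb c hc
      constructor <;> linarith
    · intro b hb c hc a ha
      have := lo a ha b hb c hc
      constructor <;> linarith
  · intro a ha b hb c hc
    obtain ⟨a₁, a₂, ha₁, ha₂, rfl⟩ := mem_pair.1 ha
    obtain ⟨b₁, b₂, hb₁, hb₂, rfl⟩ := mem_pair.1 hb
    obtain ⟨c₁, c₂, hc₁, hc₂, rfl⟩ := mem_pair.1 hc
    have u := mul_le_mul_of_nonneg_left (hS' a₂ ha₂ b₂ hb₂ c₂ hc₂) hn1
    have e : (n + 1) * (a₂ + b₂ + c₂) = (n + 1) * a₂ + (n + 1) * b₂ + (n + 1) * c₂ := by ring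
    have e' : (n + 1) * (2 * n') = 2 * ((n + 1) * n') := by ring
    rw [e, e'] at u
    linarith [hS a₁ ha₁ b₁ hb₁ c₁ hc₁]

/-- The digit product has at least `T · T'` solutions. -/
theorem card_solutions_pair {A B C A' B' C' : Finset ℤ} {n n' : ℤ} (hc : Config A B C n) :
    (solutions A B C n).card * (solutions A' B' C' n').card ≤
      (solutions (pair n A A') (pair n B B') (pair n C C') (n + (n + 1) * n')).card := by
  obtain ⟨-, -, hA, hB, hC, -⟩ := hc
  rw [← card_product]
  refine card_le_card_of_injOn
    (fun x => (x.1.1 + (n + 1) * x.2.1, x.1.2.1 + (n + 1) * x.2.2.1, x.1.2.2 + (n + 1) * x.2.2.2)) ?_ ?_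
  · rintro ⟨⟨a, b, c⟩, ⟨a', b', c'⟩⟩ hx
    rw [mem_coe] at hx ⊢
    simp only [solutions, mem_filter, mem_product] at hx ⊢
    obtain ⟨⟨⟨ha, hb, hc⟩, hs⟩, ⟨⟨ha', hb', hc'⟩, hs'⟩⟩ := hx
    refine ⟨⟨mem_pair.2 ⟨a, a', ha, ha', rfl⟩, mem_pair.2 ⟨b, b', hb, hb', rfl⟩,
      mem_pair.2 ⟨c, c', hc, hc', rfl⟩⟩, ?_⟩
    linear_combination hs + (n + 1) * hs'
  · rintro ⟨⟨a₁, b₁, c₁⟩, ⟨a₁', b₁', c₁'⟩⟩ hx ⟨⟨a₂, b₂, c₂⟩, ⟨a₂', b₂', c₂'⟩⟩ hy hxy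
    rw [mem_coe] at hx hy
    simp only [solutions, mem_filter, mem_product] at hx hy
    simp only [Prod.mk.injEq] at hxy
    obtain ⟨e1, e2, e3⟩ := hxy
    obtain ⟨r1, r1'⟩ := digit_eq (hA a₁ hx.1.1.1).1 (hA a₁ hx.1.1.1).2 (hA a₂ hy.1.1.1).1 (hA a₂ hy.1.1.1).2 e1
    obtain ⟨r2, r2'⟩ :=
      digit_eq (hB b₁ hx.1.1.2.1).1 (hB b₁ hx.1.1.2.1).2 (hB b₂ hy.1.1.2.1).1 (hB b₂ hy.1.1.2.1).2 e2
    obtain ⟨r3, r3'⟩ :=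
      digit_eq (hC c₁ hx.1.1.2.2).1 (hC c₁ hx.1.1.2.2).2 (hC c₂ hy.1.1.2.2).1 (hC c₂ hy.1.1.2.2).2 e3
    rw [r1, r1', r2, r2', r3, r3']

/-! ## The superlinear family -/

/-- For every `m`, a configuration of modulus `N = 53345^(m+1) - 1` with at least `54000^(m+1)` solutions of
`a + b + c = N`; i.e. `Val(N) ≥ 54000^(m+1) = (N+1)^{log 54000 / log 53345}`. -/
theorem val_family : ∀ m : ℕ, ∃ A B C : Finset ℤ, ∃ N : ℤ,
    N + 1 = 53345 ^ (m + 1) ∧ Config A B C N ∧ 54000 ^ (m + 1) ≤ (solutions A B C N).card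
  | 0 => ⟨A₀, B₀, C₀, 53344, by norm_num, config_ABC, by simpa using card_solutions_ABC_ge⟩
  | m + 1 => by
      obtain ⟨A, B, C, N, hN, hc, hcard⟩ := val_family m
      refine ⟨pair N A A₀, pair N B B₀, pair N C C₀, N + (N + 1) * 53344, ?_, config_pair hc config_ABC, ?_⟩
      · rw [pow_succ, ← hN]; ring
      · calc 54000 ^ (m + 1 + 1) = 54000 ^ (m + 1) * 54000 := pow_succ _ _
          _ ≤ (solutions A B C N).card * (solutions A₀ B₀ C₀ 53344).card :=
            Nat.mul_le_mul hcard card_solutions_ABC_ge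
          _ ≤ _ := card_solutions_pair hc

/-- The exponent `κ = log 54000 / log 53345` exceeds `1`. -/
theorem one_lt_kappa : 1 < Real.logb 53345 54000 := by
  rw [Real.lt_logb_iff_rpow_lt (by norm_num) (by norm_num), Real.rpow_one]
  norm_num

/-- The family with the real exponent: `#solutions ≥ (N+1)^κ`, `κ = log 54000 / log 53345 > 1`. -/
theorem val_family_rpow (m : ℕ) : ∃ A B C : Finset ℤ, ∃ N : ℤ,
    N + 1 = 53345 ^ (m + 1) ∧ Config A B C N ∧
      ((N : ℝ) + 1) ^ Real.logb 53345 54000 ≤ ((solutions A B C N).card : ℝ) := by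
  obtain ⟨A, B, C, N, hN, hc, hcard⟩ := val_family m
  refine ⟨A, B, C, N, hN, hc, ?_⟩
  have hN' : ((N : ℝ) + 1) = (53345 : ℝ) ^ (m + 1) := by exact_mod_cast hN
  have key : ((53345 : ℝ) ^ (m + 1)) ^ Real.logb 53345 54000 = (54000 : ℝ) ^ (m + 1) := by
    rw [← Real.rpow_natCast (53345 : ℝ) (m + 1), ← Real.rpow_mul (by norm_num), mul_comm,
      Real.rpow_mul (by norm_num), Real.rpow_logb (by norm_num) (by norm_num) (by norm_num), Real.rpow_natCast]
  rw [hN', key]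
  exact_mod_cast hcard

end Summit.MatrixMultiplication.MatrixMultiplication.Theorems.SoloVal
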